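import Summits.ResolutionOfSingularities.ResolutionOfSingularities.Theorems.PurelyInseparableDim4ResConePowerCone
import Mathlib.FieldTheory.IsAlgClosed.Basic
import HarnessLib

/-!
# Purely inseparable four-folds — OVER AN ALGEBRAICALLY CLOSED FIELD THE POWER CONE IS AN EXACT POWER:
# `e_G = 3`, `d < p` ⇒ `resForm s = ℓ^d` (cell `res-dim4-pi`, K2(p) lane, slice B)

[OURS · counted 0 · AI work weaker than expert review.]  Cell `res-dim4-pi` (D-0157 DOOR 2), seat `res-dim4-p-3` g3
(free hand of the K2(p) lane; companion of `…ResConeSlicesAlgClosed`: slices may be emptied over algebraically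
closed fields).  NOTHING here proves K2(p), `NoIsolatedTrap p p` or resolution of singularities in dimension ≥ 4 /
characteristic `p`.

res-dim4-p-12 g2's `ResCone.resForm_eq_C_mul_pow_of_finrank_eq_three` (p671454): in the tame range `d < p` a
state with `e_G = finrank (resVertex s) = 3` has residual cone `C c * (Σ C ℓᵢ Xᵢ)^d`, `ℓ ≠ 0` cutting out the
polar kernel.  Here:
* `polarMap_C`, `finrank_resVertex_eq_four_of_resForm_eq_C` — a CONSTANT residual cone has full polar kernel
  (so `e_G = 3` forces `c ≠ 0` and `d ≥ 1`: `resForm_ne_C_of_finrank_eq_three`);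
* **`resForm_eq_pow_of_finrank_eq_three`** — over an ALGEBRAICALLY CLOSED field the scalar is absorbed
  (`c = μ^d`, `IsAlgClosed.exists_pow_nat_eq`): `resForm s = (Σ C ℓ'ᵢ Xᵢ)^d` with `ℓ' = μ • ℓ ≠ 0` cutting out
  the same kernel — the slice-B normal form «`g = ℓ^d`» of I-4-7 with no coefficient.
bears_on: LADDER-RESOLUTION:D157-DOOR2 (res-dim4-pi · K2(p) · slice B).  Supports
stmt-ResolutionOfSingularities-16155 (helper).
-/

set_option linter.dupNamespace false -- mandated namespace of this single-conjunct summit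

noncomputable section

namespace Summit.ResolutionOfSingularities.ResolutionOfSingularities.Theorems.PIDim4

namespace ResCone

open MvPolynomial Finset
open Literature.AlgebraicGeometry.Resolution
open Literature.AlgebraicGeometry.Resolution.CentreBlowup
open Literature.AlgebraicGeometry.Resolution.Hauser2010
open Literature.AlgebraicGeometry.Resolution.HauserPerlega2019
open PointBlowup (polarMap additiveSubspace)

variable {K : Type} [Field K]

/-! ## 1. Constant cones have full polar kernel -/

/-- The polar map of a constant vanishes. [folklore] -/
theorem polarMap_C (a : K) (w : Fin 4 → K) : polarMap (C a : MvPolynomial (Fin 4) K) w = 0 := by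
  rw [polarMap_eq_sum_C_mul]
  exact Finset.sum_eq_zero fun i _ => by rw [pderiv_C, mul_zero]

/-- A state whose residual cone is a CONSTANT has full polar kernel: `finrank (resVertex s) = 4`. [folklore] -/
theorem finrank_resVertex_eq_four_of_resForm_eq_C {s : State K} {a : K} (h : resForm s = C a) :
    Module.finrank K (resVertex s) = 4 := by
  have htop : resVertex s = ⊤ := by
    refine Submodule.eq_top_iff'.mpr fun w => ?_
    show w ∈ additiveSubspace (resForm s)
    unfold additiveSubspace
    rw [LinearMap.mem_ker, h, polarMap_C]
  rw [htop, finrank_top, Module.finrank_fin_fun]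

/-- Hence at `e_G = 3` the residual cone is not a constant. [folklore] -/
theorem resForm_ne_C_of_finrank_eq_three {s : State K} (he : Module.finrank K (resVertex s) = 3) (a : K) :
    resForm s ≠ C a := fun h => by
  have h4 := finrank_resVertex_eq_four_of_resForm_eq_C h
  omega

/-! ## 2. Over an algebraically closed field the power cone is an exact power -/

/-- Scaling a linear form: `C μ * Σ C ℓᵢ Xᵢ = Σ C (μ ℓᵢ) Xᵢ`. [folklore] -/
theorem C_mul_sum_C_mul_X (μ : K) (ℓ : Fin 4 → K) :
    C μ * (∑ i, C (ℓ i) * (X i : MvPolynomial (Fin 4) K)) = ∑ i, C (μ * ℓ i) * X i := by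
  rw [Finset.mul_sum]
  exact Finset.sum_congr rfl fun i _ => by rw [← mul_assoc, ← C_mul]

/-- **OVER AN ALGEBRAICALLY CLOSED FIELD THE `e_G = 3` CONE IS AN EXACT `d`-TH POWER** (tame range): for a state
with `ord₀ F = o`, shade `d = o − |r| < p` and polar-kernel rank `3` over an algebraically closed field, the
residual cone is `(Σ C ℓᵢ Xᵢ)^d` for a non-zero linear form `ℓ` vanishing exactly on `resVertex s` (the scalar of
`resForm_eq_C_mul_pow_of_finrank_eq_three` is a `d`-th power and is absorbed into `ℓ`).
[OURS] [cite: CossartJannsenSaito2020, Def. 2.8 (directrix of a cone)] -/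
theorem resForm_eq_pow_of_finrank_eq_three (p : ℕ) [Fact p.Prime] [CharP K p] [IsAlgClosed K] {s : State K}
    {o : ℕ} (ho : ordZero s.F = o) (hd : o - s.r.degree < p)
    (he : Module.finrank K (resVertex s) = 3) :
    ∃ ℓ : Fin 4 → K, ℓ ≠ 0 ∧ (∀ w, w ∈ resVertex s ↔ ∑ i, ℓ i * w i = 0) ∧
      resForm s = (∑ i, C (ℓ i) * X i) ^ (o - s.r.degree) := by
  obtain ⟨ℓ, c, hℓ0, hmem, hc⟩ := resForm_eq_C_mul_pow_of_finrank_eq_three p ho hd he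
  -- the exponent is positive and the scalar non-zero: otherwise the cone would be a constant
  have hd0 : 0 < o - s.r.degree := by
    rcases Nat.eq_zero_or_pos (o - s.r.degree) with h0 | h0
    · rw [h0, pow_zero, mul_one] at hc
      exact absurd hc (resForm_ne_C_of_finrank_eq_three he c)
    · exact h0
  have hc0 : c ≠ 0 := by
    rintro rfl
    rw [C_0, zero_mul, ← C_0] at hc
    exact resForm_ne_C_of_finrank_eq_three he 0 hc
  obtain ⟨μ, hμ⟩ := IsAlgClosed.exists_pow_nat_eq c hd0
  have hμ0 : μ ≠ 0 := by
    rintro rfl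
    rw [zero_pow hd0.ne'] at hμ
    exact hc0 hμ.symm
  refine ⟨fun i => μ * ℓ i, ?_, ?_, ?_⟩
  · intro h0
    apply hℓ0
    funext i
    have hi := congr_fun h0 i
    simp only [Pi.zero_apply, mul_eq_zero] at hi
    rcases hi with hi | hi
    · exact absurd hi hμ0
    · exact hi
  · intro w
    rw [hmem w]
    have hfac : ∑ i, μ * ℓ i * w i = μ * ∑ i, ℓ i * w i := by
      rw [Finset.mul_sum]
      exact Finset.sum_congr rfl fun i _ => by rw [mul_assoc]
    rw [hfac, mul_eq_zero, or_iff_right hμ0]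
  · rw [hc, ← hμ, C_pow, ← mul_pow, C_mul_sum_C_mul_X]

end ResCone

end Summit.ResolutionOfSingularities.ResolutionOfSingularities.Theorems.PIDim4

end
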